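import Literature.MathematicalPhysics.QuantumFieldTheory.Balaban1983to89.B5G183RateO2Op

/-!
# Bałaban [CMP 95 (1984)] (1.83)/(1.89) at `U = 1`: PLANTING of b05's five-piece decomposition of a
weighted fibre `D_{w₁} G(p′) D_{w₂}^*` and the operator algebra of the piece DIFFERENCES between two levels
— the kit for the one remaining order-two currency `B5G183RateO2Op.OrderTwoOpRateResidualW1`

HONEST FRAMING (cell `pub-balaban`, T⁴ programme, estimate NE2 = U1a «η-rate, linear theory»).  Finite
torus, lattice spacing `η = 1/n`, trivial background `U = 1`, one nonzero reduced momentum `p′ = s` at a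
time (`ℓ²`-operator norm on the alias classes `× Fin d`).  Nothing here is about infinite volume,
`U ≠ 1`, a mass gap, or any summit statement.  Bałaban prints NO rate; the pairing `ι`/`plant`, the
extensions and every statement below are OURS ([folklore]).  THIS MODULE IS PURE BOOKKEEPING: it proves no
estimate of (1.83); it records, kernel-checked, the algebra by which the successor reduces the typed
residual `OrderTwoOpRateResidualW1` (one King weight per derivative) to `ℓ²`-VECTOR rates that the
package already has (`B5G183RateL2.xVec_rate_sq_le`, `bVec_rate_sq_le`, … — stated there for ANY weight
`|w(k)| ≤ ‖q̃_k‖` with paired rate `c_w‖q̃_k‖²/N`, which `W·∂` satisfies with `c_w = 6`).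

WHAT IS PRINTED.  [Balaban1984PropagatorsI] p. 33: «Proposition 1.1. The operator G is a symmetric
operator on L²(T_η) and ‖GJ‖, ‖∇GJ‖, ‖G∇*J‖, ‖∇G∇*J‖, ‖∇∇GJ‖, ‖G∇*∇*J‖ ≤ γ₀⁻¹‖J‖, (1.89)»; p. 32,
(1.87)–(1.88): the `l′ = l` cancellation and the bracket at `l = 0` behind b05's decomposition
`B5Prop11Bound.Fiber.sandwich_G_eq` («D_{w₁} G D_{w₂}^* = diagonal + 3 block-rank-one + rank-one»).
[King1986] p. 672: «To analyze the m = 0 term in (4.19), we successively replace each factor by the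
corresponding one … and bound the error.» (renders ref1 p016/p017, king p024 read as images by this
seat.)

WHAT THIS MODULE PROVES (kernel, [folklore]).  `plant_R` = `B5G183RateOp.plant` (transport of a
level-`N` operator to the level-`RN` classes along King's pairing `ι`, zero on the unpaired classes),
`extend` = `B5G183RateO2Op.extend`.
 §1 `plant_add` — planting is additive.
 §2 the zero-extensions `extP` (vectors on classes `× Fin d`) and `extV` (families of class vectors) and
    **`plant_diagonal`**, **`plant_blockR`**, **`plant_rankOne`**: planting a diagonal / block-rank-one /
    rank-one matrix gives the diagonal / block-rank-one / rank-one matrix of the zero-extended data.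
 §3 the trilinear split of piece differences `blockR_sub_blockR`, `rankOne_sub_rankOne` and the bounds
    **`opNorm_blockR_sub_blockR_le`**, **`opNorm_rankOne_sub_rankOne_le`** (`‖c·A⊗B̄ − c′·A′⊗B̄′‖ ≤
    |c − c′|·|A||B| + |c′|·|A − A′||B| + |c′|·|A′||B − B′|` in `ℓ²` norms, from b05's `opNorm_blockR_le` /
    `opNorm_rankOne_le`), `opNorm_diagonal_sub_le`.
 §4 `ℓ²` bookkeeping of extensions along `ι`: **`sum_sq_sub_extV`** / **`sum_sq_sub_extP`** (`Σ_K |v(K) −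
    ext w(K)|² = Σ_k |v(ιk) − w(k)|² + Σ_{K unpaired} |v(K)|²`, `B5Hk163RateSum.sum_split_iota`) and
    `sum_sq_extV` / `sum_sq_extP` (the extension is an `ℓ²` isometry).
 §5 **`residual_eq_pieces`**: for ANY two fibres `F` (classes of level `RN`) and `F′` (level `N`) and any
    weights, `D_a F.G D_b^* − plant_R(D_{a′} F′.G D_{b′}^*)` is the sum of the FIVE piece differences
    (diagonal `dg`, the blocks `R`, `C1`, `C2`, the rank-one `T` of b05, level `RN` minus the planted =
    zero-extended level `N` piece), and **`opNorm_residual_le_pieces`** (its norm is at most the sum of the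
    five piece-difference norms, b05's `norm_add₅_le`); **`residualW1_le_pieces`** specialises to the
    currency `W∂_ν ⊗ W∂_{ν′}` of `OrderTwoOpRateResidualW1`.

WHAT REMAINS / NOT CLAIMED: the five piece differences are NOT estimated here (that is the successor's
work: scalar rates of `cR = −a/φ_μ`, `cT`, the centre entries via (1.87)/(1.88), and the vector rates of
`B5G183RateL2` in §4's currency); nothing about print.
-/

noncomputable section

namespace Literature.MathematicalPhysics.QuantumFieldTheory.Balaban1983to89.B5G183RatePieces

open scoped BigOperators ComplexConjugate Matrix.Norms.L2Operator
open Finset Complex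
open Literature.MathematicalPhysics.QuantumFieldTheory.Balaban1983to89.B4Strip
open Literature.MathematicalPhysics.QuantumFieldTheory.Balaban1983to89.B5Prop11Fiber
open Literature.MathematicalPhysics.QuantumFieldTheory.Balaban1983to89.B5Prop11Bound
open Literature.MathematicalPhysics.QuantumFieldTheory.Balaban1983to89.B5Hk163Rate
open Literature.MathematicalPhysics.QuantumFieldTheory.Balaban1983to89.B5Hk163RateSum
open Literature.MathematicalPhysics.QuantumFieldTheory.Balaban1983to89.B5G183RateOp
open Literature.MathematicalPhysics.QuantumFieldTheory.Balaban1983to89.B5G183RateO2Diag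
open Literature.MathematicalPhysics.QuantumFieldTheory.Balaban1983to89.B5G183RateO2Op
open Literature.MathematicalPhysics.QuantumFieldTheory.King1986

variable {d N R : ℕ} [NeZero N] [NeZero R]

/-! ## §1 Planting is additive [folklore] -/

omit [NeZero N] in
/-- `plant (M₁ + M₂) = plant M₁ + plant M₂`. [folklore] -/
theorem plant_add {s : Fin d → ℝ}
    (M₁ M₂ : Matrix ((Fin d → Fin N) × Fin d) ((Fin d → Fin N) × Fin d) ℂ) :
    plant R s (M₁ + M₂) = plant R s M₁ + plant R s M₂ := by
  ext i j
  rw [Matrix.add_apply]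
  unfold plant
  cases hi : unpair R s i.1 with
  | none => simp
  | some k =>
    cases hj : unpair R s j.1 with
    | none => simp
    | some k' => simp

/-! ## §2 Zero-extensions along `ι` and the planting of structured pieces [folklore] -/

/-- zero-extension along `ι × id` of a vector on the level-`N` classes `× Fin d`. [folklore] -/
def extP (R : ℕ) [NeZero R] (s : Fin d → ℝ) (x : (Fin d → Fin N) × Fin d → ℂ)
    (I : (Fin d → Fin (R * N)) × Fin d) : ℂ :=
  extend R s (fun k => x (k, I.2)) 0 I.1

/-- zero-extension along `ι` of a `Fin d`-indexed family of class vectors. [folklore] -/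
def extV (R : ℕ) [NeZero R] (s : Fin d → ℝ) (y : Fin d → (Fin d → Fin N) → ℂ)
    (μ : Fin d) (K : Fin d → Fin (R * N)) : ℂ :=
  extend R s (y μ) 0 K

omit [NeZero N] in
/-- `extP x (ιk, μ) = x (k, μ)`. [folklore] -/
theorem extP_iota (hN : 1 ≤ N) {s : Fin d → ℝ} (hs : ∀ ν, |s ν| ≤ Real.pi)
    (x : (Fin d → Fin N) × Fin d → ℂ) (k : Fin d → Fin N) (μ : Fin d) :
    extP R s x (iota R k s, μ) = x (k, μ) := by
  unfold extP
  exact extend_iota hN hs _ _ k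

omit [NeZero N] in
/-- `extP x (K, μ) = 0` on an unpaired class. [folklore] -/
theorem extP_unpaired {s : Fin d → ℝ} (x : (Fin d → Fin N) × Fin d → ℂ)
    {K : Fin d → Fin (R * N)} (hu : ∀ k : Fin d → Fin N, iota R k s ≠ K) (μ : Fin d) :
    extP R s x (K, μ) = 0 := by
  unfold extP
  rw [extend_unpaired _ _ hu]
  rfl

omit [NeZero N] in
/-- `extV y μ (ιk) = y μ k`. [folklore] -/
theorem extV_iota (hN : 1 ≤ N) {s : Fin d → ℝ} (hs : ∀ ν, |s ν| ≤ Real.pi)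
    (y : Fin d → (Fin d → Fin N) → ℂ) (μ : Fin d) (k : Fin d → Fin N) :
    extV R s y μ (iota R k s) = y μ k := by
  unfold extV
  exact extend_iota hN hs _ _ k

omit [NeZero N] in
/-- `extV y μ K = 0` on an unpaired class. [folklore] -/
theorem extV_unpaired {s : Fin d → ℝ} (y : Fin d → (Fin d → Fin N) → ℂ) (μ : Fin d)
    {K : Fin d → Fin (R * N)} (hu : ∀ k : Fin d → Fin N, iota R k s ≠ K) :
    extV R s y μ K = 0 := by
  unfold extV
  rw [extend_unpaired _ _ hu]
  rfl

omit [NeZero N] in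
/-- **planting a diagonal matrix** gives the diagonal matrix of the zero-extended entries. [folklore] -/
theorem plant_diagonal {s : Fin d → ℝ} (D : (Fin d → Fin N) × Fin d → ℂ) :
    plant R s (Matrix.diagonal D) = Matrix.diagonal (extP R s D) := by
  ext i j
  rw [Matrix.diagonal_apply (d := extP R s D)]
  unfold plant extP extend
  cases hi : unpair R s i.1 with
  | none => simp
  | some k =>
    cases hj : unpair R s j.1 with
    | none =>
      rw [if_neg]
      rintro rfl
      rw [hi] at hj
      cases hj
    | some k' =>
      show Matrix.diagonal D (k, i.2) (k', j.2) = if i = j then D (k, i.2) else 0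
      rw [Matrix.diagonal_apply]
      by_cases hij : i = j
      · subst hij
        rw [hi] at hj
        cases hj
        rw [if_pos rfl, if_pos rfl]
      · rw [if_neg hij, if_neg]
        intro h
        apply hij
        injection h with h1 h2
        have hi1 : i.1 = j.1 := by
          rw [← iota_of_unpair hi, ← iota_of_unpair hj, h1]
        exact Prod.ext hi1 h2

omit [NeZero N] in
/-- **planting a block-rank-one matrix** gives the block-rank-one matrix of the zero-extended vectors.
[folklore] -/
theorem plant_blockR {s : Fin d → ℝ} (c : Fin d → ℂ) (y₁ y₂ : Fin d → (Fin d → Fin N) → ℂ) :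
    plant R s (blockR c y₁ y₂) = blockR c (extV R s y₁) (extV R s y₂) := by
  ext i j
  unfold plant blockR extV extend
  cases hi : unpair R s i.1 with
  | none => simp
  | some k =>
    cases hj : unpair R s j.1 with
    | none => simp
    | some k' => rfl

omit [NeZero N] in
/-- **planting a rank-one matrix** gives the rank-one matrix of the zero-extended vectors. [folklore] -/
theorem plant_rankOne {s : Fin d → ℝ} (c : ℂ) (x y : (Fin d → Fin N) × Fin d → ℂ) :
    plant R s (rankOne c x y) = rankOne c (extP R s x) (extP R s y) := by
  ext i j
  unfold plant rankOne extP extend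
  cases hi : unpair R s i.1 with
  | none => simp
  | some k =>
    cases hj : unpair R s j.1 with
    | none => simp
    | some k' => rfl

/-! ## §3 Differences of structured pieces: trilinear split and operator-norm bounds [folklore] -/

section Diff

variable {α β ι : Type*} [Fintype α] [DecidableEq α] [Fintype β] [DecidableEq β] [Fintype ι]
  [DecidableEq ι]

omit [Fintype α] [DecidableEq α] [Fintype β] in
/-- `blockR c A B − blockR c′ A′ B′ = blockR (c − c′) A B + blockR c′ (A − A′) B + blockR c′ A′ (B − B′)`.
[folklore] -/
theorem blockR_sub_blockR (c c' : β → ℂ) (A A' B B' : β → α → ℂ) :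
    blockR c A B - blockR c' A' B'
      = blockR (c - c') A B + blockR c' (A - A') B + blockR c' A' (B - B') := by
  ext i j
  simp only [blockR, Matrix.sub_apply, Matrix.add_apply, Pi.sub_apply, map_sub]
  split_ifs <;> ring

omit [Fintype ι] [DecidableEq ι] in
/-- `rankOne c x y − rankOne c′ x′ y′ = rankOne (c − c′) x y + rankOne c′ (x − x′) y + rankOne c′ x′ (y − y′)`.
[folklore] -/
theorem rankOne_sub_rankOne (c c' : ℂ) (x x' y y' : ι → ℂ) :
    rankOne c x y - rankOne c' x' y'
      = rankOne (c - c') x y + rankOne c' (x - x') y + rankOne c' x' (y - y') := by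
  ext i j
  simp only [rankOne, Matrix.sub_apply, Matrix.add_apply, Pi.sub_apply, map_sub]
  ring

/-- **rate bound for a block-rank-one piece:** `‖blockR c A B − blockR c′ A′ B′‖ ≤ K₁ + K₂ + K₃` from
`|c_μ − c′_μ|·|A_μ|₂|B_μ|₂ ≤ K₁`, `|c′_μ|·|A_μ − A′_μ|₂|B_μ|₂ ≤ K₂`, `|c′_μ|·|A′_μ|₂|B_μ − B′_μ|₂ ≤ K₃`
(all `μ`). [folklore] -/
theorem opNorm_blockR_sub_blockR_le (c c' : β → ℂ) (A A' B B' : β → α → ℂ) {K₁ K₂ K₃ : ℝ}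
    (h₁ : 0 ≤ K₁) (h₂ : 0 ≤ K₂) (h₃ : 0 ≤ K₃)
    (b₁ : ∀ μ, ‖c μ - c' μ‖ * (l2n (A μ) * l2n (B μ)) ≤ K₁)
    (b₂ : ∀ μ, ‖c' μ‖ * (l2n (A μ - A' μ) * l2n (B μ)) ≤ K₂)
    (b₃ : ∀ μ, ‖c' μ‖ * (l2n (A' μ) * l2n (B μ - B' μ)) ≤ K₃) :
    ‖blockR c A B - blockR c' A' B'‖ ≤ K₁ + K₂ + K₃ := by
  rw [blockR_sub_blockR]
  have e1 : ‖blockR (c - c') A B‖ ≤ K₁ := opNorm_blockR_le _ _ _ h₁ fun μ => b₁ μ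
  have e2 : ‖blockR c' (A - A') B‖ ≤ K₂ := opNorm_blockR_le _ _ _ h₂ fun μ => b₂ μ
  have e3 : ‖blockR c' A' (B - B')‖ ≤ K₃ := opNorm_blockR_le _ _ _ h₃ fun μ => b₃ μ
  exact (norm_add₃_le).trans (by linarith)

/-- **rate bound for a rank-one piece:** `‖rankOne c x y − rankOne c′ x′ y′‖ ≤ K₁ + K₂ + K₃`. [folklore] -/
theorem opNorm_rankOne_sub_rankOne_le (c c' : ℂ) (x x' y y' : ι → ℂ) {K₁ K₂ K₃ : ℝ}
    (h₁ : 0 ≤ K₁) (h₂ : 0 ≤ K₂) (h₃ : 0 ≤ K₃)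
    (b₁ : ‖c - c'‖ * (l2n x * l2n y) ≤ K₁) (b₂ : ‖c'‖ * (l2n (x - x') * l2n y) ≤ K₂)
    (b₃ : ‖c'‖ * (l2n x' * l2n (y - y')) ≤ K₃) :
    ‖rankOne c x y - rankOne c' x' y'‖ ≤ K₁ + K₂ + K₃ := by
  rw [rankOne_sub_rankOne]
  have e1 : ‖rankOne (c - c') x y‖ ≤ K₁ := opNorm_rankOne_le _ _ _ h₁ b₁
  have e2 : ‖rankOne c' (x - x') y‖ ≤ K₂ := opNorm_rankOne_le _ _ _ h₂ b₂
  have e3 : ‖rankOne c' x' (y - y')‖ ≤ K₃ := opNorm_rankOne_le _ _ _ h₃ b₃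
  exact (norm_add₃_le).trans (by linarith)

/-- **rate bound for a diagonal piece:** `‖diagonal D − diagonal D′‖ ≤ δ` from `|D_i − D′_i| ≤ δ`.
[folklore] -/
theorem opNorm_diagonal_sub_le (D D' : ι → ℂ) {δ : ℝ} (hδ : 0 ≤ δ) (h : ∀ i, ‖D i - D' i‖ ≤ δ) :
    ‖Matrix.diagonal D - Matrix.diagonal D'‖ ≤ δ := by
  rw [Matrix.diagonal_sub]
  exact B5Prop11Bound.opNorm_diagonal_le hδ fun i => h i

end Diff

/-! ## §4 `ℓ²` bookkeeping of the extensions along `ι` [folklore] -/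

omit [NeZero N] in
/-- **`Σ_K |v(K) − extV y μ (K)|² = Σ_k |v(ιk) − y μ k|² + Σ_{K unpaired} |v(K)|²`** — the squared `ℓ²`
distance to a zero-extension splits into the PAIRED rate sum and the UNPAIRED tail (King's `m = 0` /
`|m| ≥ 1` split of (4.19)). [cite: King1986, (4.19) p.672] [folklore] -/
theorem sum_sq_sub_extV (hN : 1 ≤ N) {s : Fin d → ℝ} (hs : ∀ ν, |s ν| ≤ Real.pi)
    (v : (Fin d → Fin (R * N)) → ℂ) (y : Fin d → (Fin d → Fin N) → ℂ) (μ : Fin d) :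
    ∑ K, ‖v K - extV R s y μ K‖ ^ 2
      = ∑ k : Fin d → Fin N, ‖v (iota R k s) - y μ k‖ ^ 2
        + ∑ K ∈ Finset.univ.filter (fun K => ∀ k : Fin d → Fin N, iota R k s ≠ K), ‖v K‖ ^ 2 := by
  rw [sum_split_iota hN hs (fun K => ‖v K - extV R s y μ K‖ ^ 2)]
  congr 1
  · exact Finset.sum_congr rfl fun k _ => by rw [extV_iota hN hs]
  · exact Finset.sum_congr rfl fun K hK => by
      rw [extV_unpaired y μ (Finset.mem_filter.mp hK).2, sub_zero]

omit [NeZero N] in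
/-- `Σ_K |extV y μ (K)|² = Σ_k |y μ k|²` (the zero-extension is an `ℓ²` isometry). [folklore] -/
theorem sum_sq_extV (hN : 1 ≤ N) {s : Fin d → ℝ} (hs : ∀ ν, |s ν| ≤ Real.pi)
    (y : Fin d → (Fin d → Fin N) → ℂ) (μ : Fin d) :
    ∑ K, ‖extV R s y μ K‖ ^ 2 = ∑ k : Fin d → Fin N, ‖y μ k‖ ^ 2 := by
  rw [sum_split_iota hN hs (fun K => ‖extV R s y μ K‖ ^ 2)]
  have h0 : ∑ K ∈ Finset.univ.filter (fun K => ∀ k : Fin d → Fin N, iota R k s ≠ K),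
      ‖extV R s y μ K‖ ^ 2 = 0 :=
    Finset.sum_eq_zero fun K hK => by
      rw [extV_unpaired y μ (Finset.mem_filter.mp hK).2, norm_zero, zero_pow two_ne_zero]
  rw [h0, add_zero]
  exact Finset.sum_congr rfl fun k _ => by rw [extV_iota hN hs]

omit [NeZero N] in
/-- **`Σ_I |v(I) − extP x (I)|² = Σ_k Σ_μ |v(ιk, μ) − x(k, μ)|² + Σ_{K unpaired} Σ_μ |v(K, μ)|²`.**
[cite: King1986, (4.19) p.672] [folklore] -/
theorem sum_sq_sub_extP (hN : 1 ≤ N) {s : Fin d → ℝ} (hs : ∀ ν, |s ν| ≤ Real.pi)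
    (v : (Fin d → Fin (R * N)) × Fin d → ℂ) (x : (Fin d → Fin N) × Fin d → ℂ) :
    ∑ I, ‖v I - extP R s x I‖ ^ 2
      = ∑ k : Fin d → Fin N, ∑ μ : Fin d, ‖v (iota R k s, μ) - x (k, μ)‖ ^ 2
        + ∑ K ∈ Finset.univ.filter (fun K => ∀ k : Fin d → Fin N, iota R k s ≠ K),
            ∑ μ : Fin d, ‖v (K, μ)‖ ^ 2 := by
  rw [Fintype.sum_prod_type, sum_split_iota hN hs (fun K => ∑ μ : Fin d, ‖v (K, μ) - extP R s x (K, μ)‖ ^ 2)]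
  congr 1
  · exact Finset.sum_congr rfl fun k _ => Finset.sum_congr rfl fun μ _ => by rw [extP_iota hN hs]
  · exact Finset.sum_congr rfl fun K hK => Finset.sum_congr rfl fun μ _ => by
      rw [extP_unpaired x (Finset.mem_filter.mp hK).2, sub_zero]

omit [NeZero N] in
/-- `Σ_I |extP x (I)|² = Σ_i |x i|²`. [folklore] -/
theorem sum_sq_extP (hN : 1 ≤ N) {s : Fin d → ℝ} (hs : ∀ ν, |s ν| ≤ Real.pi)
    (x : (Fin d → Fin N) × Fin d → ℂ) :
    ∑ I, ‖extP R s x I‖ ^ 2 = ∑ i : (Fin d → Fin N) × Fin d, ‖x i‖ ^ 2 := by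
  rw [Fintype.sum_prod_type, Fintype.sum_prod_type,
    sum_split_iota hN hs (fun K => ∑ μ : Fin d, ‖extP R s x (K, μ)‖ ^ 2)]
  have h0 : ∑ K ∈ Finset.univ.filter (fun K => ∀ k : Fin d → Fin N, iota R k s ≠ K),
      ∑ μ : Fin d, ‖extP R s x (K, μ)‖ ^ 2 = 0 :=
    Finset.sum_eq_zero fun K hK => Finset.sum_eq_zero fun μ _ => by
      rw [extP_unpaired x (Finset.mem_filter.mp hK).2, norm_zero, zero_pow two_ne_zero]
  rw [h0, add_zero]
  exact Finset.sum_congr rfl fun k _ => Finset.sum_congr rfl fun μ _ => by rw [extP_iota hN hs]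

/-! ## §5 The residual as the sum of five piece differences [folklore] -/

omit [NeZero N] in
/-- **the level difference of a weighted fibre is the sum of b05's five piece differences:** for ANY
fibres `F` (classes of level `RN`), `F′` (level `N`) and weights,
`D_a F.G D_b^* − plant_R(D_{a′} F′.G D_{b′}^*) = Σ_{pieces} (piece_{F}(a,b) − piece_{F′}(a′,b′) planted)`,
the planted pieces being the pieces of the zero-extended data (§2). [cite: Balaban1984PropagatorsI,
(1.87)–(1.88) p.32; King1986, (4.19) p.672] [folklore] -/
theorem residual_eq_pieces {s : Fin d → ℝ} (F : Fiber (Fin d → Fin (R * N)) d)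
    (F' : Fiber (Fin d → Fin N) d) (a b : (Fin d → Fin (R * N)) → ℂ) (a' b' : (Fin d → Fin N) → ℂ) :
    sandwich a b F.G - plant R s (sandwich a' b' F'.G)
      = (Matrix.diagonal (F.dg a b) - Matrix.diagonal (extP R s (F'.dg a' b')))
        + (blockR F.cR (F.xw a) (F.xw b) - blockR F'.cR (extV R s (F'.xw a')) (extV R s (F'.xw b')))
        + (blockR F.cR (F.xo a) (F.xw b) - blockR F'.cR (extV R s (F'.xo a')) (extV R s (F'.xw b')))
        + (blockR F.cR (F.xw a) (F.xo b) - blockR F'.cR (extV R s (F'.xw a')) (extV R s (F'.xo b')))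
        + (rankOne F.cT (F.bw a) (F.bw b) - rankOne F'.cT (extP R s (F'.bw a')) (extP R s (F'.bw b'))) := by
  rw [F.sandwich_G_eq, F'.sandwich_G_eq, plant_add, plant_add, plant_add, plant_add, plant_diagonal,
    plant_blockR, plant_blockR, plant_blockR, plant_rankOne]
  abel

omit [NeZero N] in
/-- **the operator norm of the level difference is at most the sum of the five piece-difference norms.**
[folklore] -/
theorem opNorm_residual_le_pieces {s : Fin d → ℝ} (F : Fiber (Fin d → Fin (R * N)) d)
    (F' : Fiber (Fin d → Fin N) d) (a b : (Fin d → Fin (R * N)) → ℂ) (a' b' : (Fin d → Fin N) → ℂ) :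
    ‖sandwich a b F.G - plant R s (sandwich a' b' F'.G)‖
      ≤ ‖Matrix.diagonal (F.dg a b) - Matrix.diagonal (extP R s (F'.dg a' b'))‖
        + ‖blockR F.cR (F.xw a) (F.xw b) - blockR F'.cR (extV R s (F'.xw a')) (extV R s (F'.xw b'))‖
        + ‖blockR F.cR (F.xo a) (F.xw b) - blockR F'.cR (extV R s (F'.xo a')) (extV R s (F'.xw b'))‖
        + ‖blockR F.cR (F.xw a) (F.xo b) - blockR F'.cR (extV R s (F'.xw a')) (extV R s (F'.xo b'))‖
        + ‖rankOne F.cT (F.bw a) (F.bw b)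
            - rankOne F'.cT (extP R s (F'.bw a')) (extP R s (F'.bw b'))‖ := by
  rw [residual_eq_pieces]
  exact norm_add₅_le _ _ _ _ _

/-- **the entry point for `OrderTwoOpRateResidualW1`:** the matrix of the typed residual (one King
weight per derivative, `w1dSym = W·∂`) is bounded by the five piece-difference norms of Bałaban's fibres
at the levels `RN` and `N`. [cite: Balaban1984PropagatorsI, Prop. 1.1 (1.89) p.33; King1986,
(4.19)–(4.20) p.672] [folklore] -/
theorem residualW1_le_pieces (hN : 1 ≤ N) (hRN : 1 ≤ R * N) (a : ℝ) (ha : 0 < a) {s : Fin d → ℝ}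
    (hs : ∀ ν, |s ν| ≤ Real.pi) (hs0 : s ≠ 0) (ν ν' : Fin d) :
    let F := balabanFiber (R * N) hRN a ha s hs hs0
    let F' := balabanFiber N hN a ha s hs hs0
    let wa : (Fin d → Fin (R * N)) → ℂ := fun K => w1dSym (R * N) K s ν
    let wb : (Fin d → Fin (R * N)) → ℂ := fun K => w1dSym (R * N) K s ν'
    let wa' : (Fin d → Fin N) → ℂ := fun k => w1dSym N k s ν
    let wb' : (Fin d → Fin N) → ℂ := fun k => w1dSym N k s ν'
    ‖sandwich wa wb F.G - plant R s (sandwich wa' wb' F'.G)‖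
      ≤ ‖Matrix.diagonal (F.dg wa wb) - Matrix.diagonal (extP R s (F'.dg wa' wb'))‖
        + ‖blockR F.cR (F.xw wa) (F.xw wb) - blockR F'.cR (extV R s (F'.xw wa')) (extV R s (F'.xw wb'))‖
        + ‖blockR F.cR (F.xo wa) (F.xw wb) - blockR F'.cR (extV R s (F'.xo wa')) (extV R s (F'.xw wb'))‖
        + ‖blockR F.cR (F.xw wa) (F.xo wb) - blockR F'.cR (extV R s (F'.xw wa')) (extV R s (F'.xo wb'))‖
        + ‖rankOne F.cT (F.bw wa) (F.bw wb)
            - rankOne F'.cT (extP R s (F'.bw wa')) (extP R s (F'.bw wb'))‖ :=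
  opNorm_residual_le_pieces _ _ _ _ _ _

omit [NeZero N] in
/-- **the weights of the currency `W∂` satisfy the hypotheses of the `ℓ²` vector lemmas of
`B5G183RateL2`** (`|w(k)| ≤ ‖q̃_k‖_∞` and the paired rate `|w^{(RN)}(ιk) − w^{(N)}(k)| ≤ 6‖q̃_k‖²/N`):
ONE weight per derivative is enough at the VECTOR level because the vectors `x_μ`, `b` themselves decay.
[cite: King1986, (4.20) p.672] [folklore] -/
theorem w1dSym_weight_hyps (hN : 1 ≤ N) (hR : 1 ≤ R) {s : Fin d → ℝ} (hs : ∀ ν, |s ν| ≤ Real.pi)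
    (ν : Fin d) :
    (∀ k : Fin d → Fin N, ‖w1dSym N k s ν‖ ≤ ‖symmAlias N k s‖)
      ∧ ∀ k : Fin d → Fin N,
          ‖w1dSym (R * N) (iota R k s) s ν - w1dSym N k s ν‖ ≤ 6 * ‖symmAlias N k s‖ ^ 2 / N := by
  have hW : ∀ k : Fin d → Fin N, 0 ≤ Wc N k s ∧ Wc N k s ≤ 1 := fun k => Wc_nonneg_le_one k hs
  refine ⟨fun k => ?_, fun k => ?_⟩
  · unfold w1dSym
    rw [norm_mul, Complex.norm_real, Real.norm_eq_abs, abs_of_nonneg (hW k).1]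
    calc Wc N k s * ‖dSym N k s ν‖ ≤ 1 * ‖symmAlias N k s‖ :=
          mul_le_mul (hW k).2 (B5G183RateL2.norm_dSym_le hN k s ν) (norm_nonneg _) zero_le_one
      _ = ‖symmAlias N k s‖ := one_mul _
  · unfold w1dSym
    rw [Wc_iota hN k hs, ← mul_sub, norm_mul, Complex.norm_real, Real.norm_eq_abs,
      abs_of_nonneg (hW k).1]
    calc Wc N k s * ‖dSym (R * N) (iota R k s) s ν - dSym N k s ν‖
        ≤ 1 * (6 * ‖symmAlias N k s‖ ^ 2 / N) :=
          mul_le_mul (hW k).2 (B5G183RateL2.dSym_rate_le hN hR k hs ν) (norm_nonneg _) zero_le_one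
      _ = 6 * ‖symmAlias N k s‖ ^ 2 / N := one_mul _

end Literature.MathematicalPhysics.QuantumFieldTheory.Balaban1983to89.B5G183RatePieces
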